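import Literature.AlgebraicGeometry.HodgeTheory.AnalytificationImmersivePoint
import Literature.AlgebraicGeometry.HodgeTheory.HyperplaneClassPullback
import Literature.AlgebraicGeometry.HodgeTheory.KaehlerClass
import Literature.AlgebraicGeometry.HodgeTheory.ComplexConjugationHolds
import Literature.AlgebraicGeometry.HodgeTheory.GysinKernelProofs
import Literature.AlgebraicGeometry.HodgeTheory.HolomorphicBundleChernCharacterTopDegree
import Literature.Geometry.Kaehler.SemipositiveTwoFormPow
import Literature.Geometry.Manifold.DeRhamFundamentalClassPairing
import Literature.NumberTheory.Transcendental.DeRhamTheoremMultiplicative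
import Literature.NumberTheory.Transcendental.ComplexFormsPullback
import Literature.AlgebraicTopology.SingularHomology.CompactGroupExteriorCohomology
import HarnessLib

/-!
# The fundamental class of a subvariety of a smooth projective variety is not homologous to zero (Wirtinger)

Family `hodge`, layer `Literature/AlgebraicGeometry/HodgeTheory`. Theorems-only file (no definitions,
no named facts; D-0026). P. Griffiths, J. Harris, *Principles of Algebraic Geometry* (1978), Ch. 0
§7 with Ch. 0 §2 (Wirtinger's theorem): the fundamental class of a `d`-dimensional analytic subvariety
of a compact Kähler manifold is non-zero, its pairing with `[ω]^d` being `d! · vol > 0`. On the summit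
carriers, for a morphism `τ : V ⟶ Y` of smooth projective complex varieties (`dim V = d`) and the
fundamental class `[V(ℂ)]` of any orientation family `μ` (`ComplexGysin.OrientationFamily`):

* `map_fundamentalClass_ne_zero_of_map_ne_zero` — topology: if some class of `H^{2d}(T; ℂ)` pulls back
  non-trivially to `H^{2d}(V(ℂ); ℂ)` along `f : V(ℂ) → T`, then `f_* [V(ℂ)] ≠ 0` (Kronecker pairing,
  Poincaré duality `H^{2d} ≅ H₀` for `μ`, `ε : H₀ ≅ ℂ`);
* `twoFormPow_one`, `cupPowTwo_ofRealClass_twoFormPow` — de Rham: a multiplicative real comparison `e`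
  (Warner Thm. 5.45) sends `[θᵖ]` to `(e[θ] ⊗ 1)ᵖ` for every closed smooth `2`-form `θ`;
* `map_fundamentalClass_ne_zero_of_stalkMap_surjective` — **if at ONE complex point `P` of `V` the map
  of local rings `𝒪_{Y, τP} → 𝒪_{V, P}` is surjective, then `τ(ℂ)_* [V(ℂ)] ≠ 0` in `H_{2d}(Y(ℂ); ℂ)`.**
  The hypothesis covers closed immersions of smooth subvarieties and resolutions of singularities of
  `d`-dimensional closed subvarieties read in `Y` (over the isomorphism locus); it fails, as it must,
  for constant maps. Proof: Hodge models `A`, `B` of `Y`, `V`; a projective embedding `κ : Y ⟶ ℙᴺ` and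
  its restricted Fubini–Study form `θ_κ` (Kähler, positive definite: `fubiniStudyPullbackForm_pos`); the
  holomorphic `τ^an : V^an → Y^an` (`HodgeModel.anMap`) is immersive at the point over `P`
  (`AnalytificationImmersivePoint`), so `θ = (τ^an)^* θ_κ` is a smooth closed `J`-invariant
  semi-positive `2`-form on `V^an`, positive at that point, whence `∫ θ^d > 0` and `[θ^d] ≠ 0`
  (`SemipositiveTwoFormPow`); the integration comparisons of `V^an` and `Y^an` are natural across
  model spaces (`integrationDeRhamIsoFamily_map_of_contMDiff`) and multiplicative, so
  `B^*(τ^* H^d) = e[θ^d] ⊗ 1 ≠ 0` for the hyperplane-type class `H` of `Y` (`A^* H = e[θ_κ] ⊗ 1`), and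
  the first result concludes with `c = H^d`.

Consumer: `AlgebraicClassesHodgeTypeHolds` — Voisin I Prop. 11.20 ("the class of an algebraic cycle
is a Hodge class") unconditionally on the summit carriers, and thereby the route item `OrthogonalSplit`
of `Summits/HodgeConjecture/HodgeConjecture/Theses/EndoscopicMiddleDegree`.

## References

* [GriffithsHarrisPrinciples1978] P. Griffiths, J. Harris, Principles of Algebraic Geometry (Wiley
  1978), Ch. 0 §2 p. 31 (Wirtinger theorem), Ch. 0 §7 pp. 109–111.
* [VoisinHodgeI2002] C. Voisin, Hodge Theory and Complex Algebraic Geometry I (CUP 2002), §3.1.3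
  Lemma 3.8, Cor. 3.9; §3.3.2 Lemma 3.16; §11.1.2 (Lemma 11.14, Cor. 11.15, Remark 11.16).
* [HatcherAT2002] A. Hatcher, Algebraic Topology (CUP 2002), §2.1 Prop. 2.7, §3.1 p. 201, §3.3
  Thm. 3.30.
* [WarnerGTM94] F. W. Warner, Foundations of Differentiable Manifolds and Lie Groups (1983), 2.6,
  Thm. 5.45.
-/

noncomputable section

open scoped Manifold ContDiff Topology
open CategoryTheory AlgebraicGeometry Module
open Literature.AlgebraicTopology.SingularHomology
open Literature.Geometry.Kaehler Literature.NumberTheory.Transcendental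
open Literature.AlgebraicGeometry.Motives (ComplexPoints AlgPoints IsSmoothProjective)
open Literature.AlgebraicGeometry.Motives.AnalytificationKaehler (fubiniStudyPullbackForm
  fubiniStudyPullbackForm_pos fubiniStudyPullbackForm_tangentJ fubiniStudyPullbackForm_self_tangentJ_nonneg)

namespace Literature.AlgebraicGeometry.HodgeTheory

section HodgeTheory

variable {n d : ℕ} {Y V : Motives.SchemeOver ℂ}

/-! ### Topology: a class pulling back non-trivially to the top degree detects `τ_* [V]` -/

/-- **If some class of `H^{2d}(T; ℂ)` pulls back to a NON-ZERO class of `H^{2d}(V(ℂ); ℂ)` along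
`f : V(ℂ) → T`, then `f_* [V(ℂ)] ≠ 0`** (`V` smooth projective of dimension `d`, `[V(ℂ)]` the
fundamental class of any orientation family): `⟨f^* c, [V]⟩ = ⟨c, f_* [V]⟩` (naturality of the
Kronecker pairing), and on the closed connected `2d`-manifold `V(ℂ)` a non-zero top class pairs
non-trivially with `[V]` — Poincaré duality `H^{2d} ≅ H₀` (`OrientationFamily.hasPoincareDuality`) and
`ε : H₀ ≅ ℂ` (`isIso_ε_of_pathConnectedSpace`). [cite: HatcherAT2002, §3.3 Thm. 3.30 and §3.1 p. 201] -/
theorem map_fundamentalClass_ne_zero_of_map_ne_zero (μ : OrientationFamily)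
    (hV : IsSmoothProjective d V) {T : Type} [TopologicalSpace T] (f : C(ComplexPoints V, T))
    {c : singularCohomology ℂ ℂ T (2 * d)}
    (hc : singularCohomology.map ℂ ℂ f (2 * d) c ≠ 0) :
    singularHomology.map ℂ ℂ f (2 * d) (μ hV).fundamentalClass ≠ 0 := by
  intro h0
  haveI : PathConnectedSpace (ComplexPoints V) := pathConnectedSpace_complexPoints_of_isSmoothProjective hV
  -- `⟨f^* c, [V]⟩ = ⟨c, f_* [V]⟩ = 0`
  have h1 : kroneckerPairing ℂ ℂ (ComplexPoints V) (2 * d) (singularCohomology.map ℂ ℂ f (2 * d) c)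
      (μ hV).fundamentalClass = 0 := by
    rw [kroneckerPairing_map, h0, map_zero]
  -- but a non-zero top class pairs non-trivially with `[V]`
  set a := singularCohomology.map ℂ ℂ f (2 * d) c with ha
  have hPD := OrientationFamily.hasPoincareDuality μ hV (show 2 * d + 0 = 2 * d by omega)
  have h2 : capProduct (show 2 * d + 0 = 2 * d by omega) a (μ hV).fundamentalClass ≠ 0 := by
    intro h
    apply hc
    apply hPD.1
    rw [poincareDualityMap_apply, poincareDualityMap_apply, map_zero, LinearMap.zero_apply]
    exact h
  haveI := singularHomology.isIso_ε_of_pathConnectedSpace (R := ℂ) (M := ℂ) (X := ComplexPoints V)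
  have h3 : (singularHomology.ε ℂ ℂ (ComplexPoints V))
      (capProduct (show 2 * d + 0 = 2 * d by omega) a (μ hV).fundamentalClass) ≠ 0 := by
    intro h
    apply h2
    exact (ConcreteCategory.bijective_of_isIso (singularHomology.ε ℂ ℂ (ComplexPoints V))).1
      (by rw [h, map_zero])
  apply h3
  rw [kroneckerPairing_apply] at h1
  exact ULift.down_injective h1

/-! ### De Rham: the comparison is multiplicative on powers of a closed `2`-form -/

section DeRham

variable {E : Type} [NormedAddCommGroup E] [NormedSpace ℂ E]
  {M : Type} [TopologicalSpace M] [ChartedSpace E M] [IsManifold 𝓘(ℝ, E) ∞ M] [T2Space M]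
  [SigmaCompactSpace M]

omit [IsManifold 𝓘(ℝ, E) ∞ M] [T2Space M] [SigmaCompactSpace M] in
/-- `θ¹ = θ` up to the degree cast `2 · 1 = 2` (from `1 ∧ β = β`,
`ContinuousAlternatingMap.constOfIsEmpty_one_wedge`; the tree's `kaehlerFormPow_one` for an arbitrary
`2`-form). [cite: WarnerGTM94, 2.6] -/
theorem twoFormPow_one (θ : MForm 𝓘(ℝ, E) M ℝ 2) :
    MForm.twoFormPow 𝓘(ℝ, E) M θ 1 = θ.castDeg (Nat.mul_one 2).symm := by
  have key : ∀ (c : E [⋀^Fin 0]→L[ℝ] ℝ) (b : E [⋀^Fin 2]→L[ℝ] ℝ),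
      c = ContinuousAlternatingMap.constOfIsEmpty ℝ E (Fin 0) (1 : ℝ) →
        ∀ w : Fin (0 + 2) → E, c.wedge b w = b (fun i ↦ w (Fin.cast (Nat.zero_add 2).symm i)) := by
    rintro c b rfl w
    rw [ContinuousAlternatingMap.constOfIsEmpty_one_wedge]
    rfl
  funext x
  ext v
  simp only [MForm.twoFormPow_succ, MForm.twoFormPow_zero, Literature.Geometry.Kaehler.MForm.castDeg_apply,
    Literature.Geometry.Kaehler.MForm.wedge_apply]
  exact key _ _ (by ext w; rfl) _

/-- **`(e[θ] ⊗ 1)ᵖ = e[θᵖ] ⊗ 1`** for a multiplicative real de Rham comparison `e` (Warner Thm. 5.45),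
a closed smooth `2`-form `θ` and `p ≥ 1` (`cupPowTwo`, the tree's cup powers of a degree-`2` class;
`⊗ 1` is multiplicative, `ofRealClass_cupProduct`; `[θ^{p+1}] = [θᵖ] ⌣ [θ]`, `deRhamCohomology.cup_mk_mk`;
the tree's `cupPowTwo_ofRealClass_kaehlerClass` is the case of a Kähler form).
[cite: WarnerGTM94, Thm. 5.45] -/
theorem cupPowTwo_ofRealClass_twoFormPow (e : DeRhamIsoFamily 𝓘(ℝ, E)) (hem : e.IsMultiplicative)
    {θ : MForm 𝓘(ℝ, E) M ℝ 2} (hθ : θ ∈ closedSmoothForms 𝓘(ℝ, E) M ℝ 2) {p : ℕ} (hp : 1 ≤ p) :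
    haveI : WedgeFacts 𝓘(ℝ, E) M ℝ :=
      wedgeFacts_of_assoc 𝓘(ℝ, E) M ℝ (ContinuousAlternatingMap.WedgeAssoc_holds ℝ E ℝ)
    cupPowTwo (ofRealClass M 2 (e M 2 (deRhamCohomology.mk ⟨θ, hθ⟩))) p =
      ofRealClass M (2 * p) (e M (2 * p) (deRhamCohomology.mk
        ⟨MForm.twoFormPow 𝓘(ℝ, E) M θ p, twoFormPow_mem_closedSmoothForms hθ p⟩)) := by
  haveI : WedgeFacts 𝓘(ℝ, E) M ℝ :=
    wedgeFacts_of_assoc 𝓘(ℝ, E) M ℝ (ContinuousAlternatingMap.WedgeAssoc_holds ℝ E ℝ)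
  induction p, hp using Nat.le_induction with
  | base =>
    rw [cupPowTwo_one]
    have hone : (⟨MForm.twoFormPow 𝓘(ℝ, E) M θ 1, twoFormPow_mem_closedSmoothForms hθ 1⟩ :
        closedSmoothForms 𝓘(ℝ, E) M ℝ (2 * 1)) = ⟨θ, hθ⟩ := by
      apply Subtype.ext
      change MForm.twoFormPow 𝓘(ℝ, E) M θ 1 = θ
      rw [twoFormPow_one]
      rfl
    rw [hone]
  | succ p hp ih =>
    have hcup : deRhamCohomology.cup (two_mul_add_two p)
        (deRhamCohomology.mk
          ⟨MForm.twoFormPow 𝓘(ℝ, E) M θ p, twoFormPow_mem_closedSmoothForms hθ p⟩)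
        (deRhamCohomology.mk ⟨θ, hθ⟩) =
        deRhamCohomology.mk ⟨MForm.twoFormPow 𝓘(ℝ, E) M θ (p + 1),
          twoFormPow_mem_closedSmoothForms hθ (p + 1)⟩ := by
      rw [deRhamCohomology.cup_mk_mk]
      rfl
    rw [cupPowTwo_succ, ih, ← ofRealClass_cupProduct, ← hem, hcup]

end DeRham

/-! ### The non-vanishing theorem -/

/-- **The fundamental class of a subvariety of a smooth projective variety is not homologous to zero
— push-forward form, at a point where the morphism is a closed immersion to first order.** Let `Y`,
`V` be smooth projective over `ℂ` of dimensions `n`, `d`, `τ : V ⟶ Y`, and suppose that at ONE complex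
point `P` of `V` the map of local rings `𝒪_{Y, τP} → 𝒪_{V, P}` is surjective (e.g. `τ` a closed
immersion, or a resolution of singularities of a `d`-dimensional closed subvariety read in `Y`, at a
point over its isomorphism locus). Then for every orientation family `μ`,
`τ(ℂ)_* [V(ℂ)] ≠ 0` in `H_{2d}(Y(ℂ); ℂ)`. Proof (Wirtinger / Griffiths–Harris Ch. 0 §7): with Hodge
models `A`, `B`, a projective embedding `κ : Y ⟶ ℙᴺ`, its restricted Fubini–Study form `θ_κ` on `Y^an`
and the holomorphic `τ^an : V^an → Y^an`, the form `θ = (τ^an)^* θ_κ` is a smooth closed `J`-invariant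
semi-positive `2`-form on `V^an`, positive definite at the point over `P` (`θ_κ` is positive,
`fubiniStudyPullbackForm_pos`; `dτ^an` is injective there,
`HodgeModel.injective_mfderiv_anMap_of_forall_exists_eval_eq` with `exists_eval_eq_of_stalkMap_surjective`),
so `∫_{V^an} θ^d > 0` and `[θ^d] ≠ 0` (`twoFormPow_finrank_not_mem_exactSmoothForms`); under the
integration comparison `[θ^d] ↦ (τ^* H)^d` for the hyperplane-type class `H` of `Y` (`A^* H = e[θ_κ] ⊗ 1`;
naturality of `e` across model spaces, `integrationDeRhamIsoFamily_map_of_contMDiff`, and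
multiplicativity, `cupPowTwo_ofRealClass_twoFormPow`), so `τ^*(H^d) ≠ 0` in `H^{2d}(V(ℂ); ℂ)` and
`map_fundamentalClass_ne_zero_of_map_ne_zero` concludes.
[cite: GriffithsHarrisPrinciples1978, Ch. 0 §7 pp. 109–111 and Ch. 0 §2 p. 31]
[cite: VoisinHodgeI2002, §3.1.3 Lemma 3.8, §3.3.2 Lemma 3.16 and §11.1.2] -/
theorem map_fundamentalClass_ne_zero_of_stalkMap_surjective (μ : OrientationFamily)
    (hY : IsSmoothProjective n Y) (hV : IsSmoothProjective d V) (τ : V ⟶ Y) (P : ComplexPoints V)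
    (hτ : Function.Surjective (τ.left.stalkMap P.pt)) :
    singularHomology.map ℂ ℂ (Motives.AlgPoints.mapContinuous (L := ℂ) τ) (2 * d)
      (μ hV).fundamentalClass ≠ 0 := by
  classical
  haveI : PathConnectedSpace (ComplexPoints V) := pathConnectedSpace_complexPoints_of_isSmoothProjective hV
  -- dimension `0`: `τ^* 1 = 1 ≠ 0`
  rcases Nat.eq_zero_or_pos d with rfl | hd1
  · refine map_fundamentalClass_ne_zero_of_map_ne_zero μ hV _ (c := singularCohomology.one ℂ _) ?_
    rw [singularCohomology.map_one]
    intro h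
    have h1 := singularCohomologyZeroEquiv_one (R := ℂ) (X := ComplexPoints V)
    rw [h, map_zero] at h1
    exact zero_ne_one h1
  -- Hodge models, the embedding, the analytified morphism
  obtain ⟨A⟩ := (nonempty_hodgeModel_holds (n := n) (X := Y)).nonempty hY
  obtain ⟨B⟩ := (nonempty_hodgeModel_holds (n := d) (X := V)).nonempty hV
  obtain ⟨N, κ, hκ⟩ := hY.isProjectiveOver
  haveI := hκ
  haveI := hY.smoothOfRelativeDimension
  haveI : Nonempty B.carrier := B.nonempty_carrier hV
  haveI : CompactSpace B.carrier := by
    haveI := Motives.ComplexPoints.compactSpace_of_isSmoothProjective hV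
    exact B.isAnalytification.homeomorph.symm.compactSpace
  haveI : CompactSpace A.carrier := by
    haveI := Motives.ComplexPoints.compactSpace_of_isSmoothProjective hY
    exact A.isAnalytification.homeomorph.symm.compactSpace
  haveI : SecondCountableTopology B.carrier := ChartedSpace.secondCountable_of_sigmaCompact B.model B.carrier
  haveI : SecondCountableTopology A.carrier := ChartedSpace.secondCountable_of_sigmaCompact A.model A.carrier
  haveI : PullbackFacts 𝓘(ℝ, B.model) B.carrier 𝓘(ℝ, A.model) A.carrier ℝ := PullbackFacts.real_of_complex
  haveI : WedgeFacts 𝓘(ℝ, B.model) B.carrier ℝ :=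
    wedgeFacts_of_assoc 𝓘(ℝ, B.model) B.carrier ℝ (ContinuousAlternatingMap.WedgeAssoc_holds ℝ B.model ℝ)
  set F : B.carrier → A.carrier := HodgeModel.anMap A B τ with hFdef
  have hFd : MDifferentiable 𝓘(ℂ, B.model) 𝓘(ℂ, A.model) F := HodgeModel.mdifferentiable_anMap A B τ hV hY
  have hFs : ContMDiff 𝓘(ℝ, B.model) 𝓘(ℝ, A.model) ∞ F := HodgeModel.contMDiff_anMap A B τ hV hY
  -- the point `b₀` over `P`: `dτ^an(b₀)` is injective
  set b₀ : B.carrier := B.isAnalytification.homeomorph.symm P with hb₀def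
  have hb₀ : B.toComplexPoints b₀ = P := B.isAnalytification.homeomorph.apply_symm_apply P
  have hinjC : Function.Injective (mfderiv 𝓘(ℂ, B.model) 𝓘(ℂ, A.model) F b₀) := by
    refine HodgeModel.injective_mfderiv_anMap_of_forall_exists_eval_eq A B hY hV τ b₀ fun U s hU ↦ ?_
    rw [hb₀] at hU ⊢
    exact exists_eval_eq_of_stalkMap_surjective τ P hτ U s hU
  have hinj : Function.Injective (mfderiv 𝓘(ℝ, B.model) 𝓘(ℝ, A.model) F b₀) := by
    rw [mfderiv_real_eq_restrictScalars (hFd b₀)]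
    exact hinjC
  -- the forms `θ_κ` on `Y^an` and `θ = (τ^an)^* θ_κ` on `V^an`
  set θκ : MForm 𝓘(ℝ, A.model) A.carrier ℝ 2 := fubiniStudyPullbackForm A.model κ A.toComplexPoints with hθκ
  have hθκc : θκ ∈ closedSmoothForms 𝓘(ℝ, A.model) A.carrier ℝ 2 := A.fubiniStudyPullbackForm_mem_closedSmoothForms κ
  set θ : MForm 𝓘(ℝ, B.model) B.carrier ℝ 2 := θκ.pullback 𝓘(ℝ, B.model) F with hθdef
  have hθc : θ ∈ closedSmoothForms 𝓘(ℝ, B.model) B.carrier ℝ 2 := pullback_mem_closedSmoothForms hFs hθκc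
  have hθs : IsSmoothForm θ := ((mem_closedSmoothForms_iff θ).1 hθc).1
  -- pointwise: `θ x (v, w) = θ_κ (F x) (dF v, dF w)` with `dF (iv) = i dF v`
  have hθapp : ∀ (x : B.carrier) (v w : B.model),
      (show B.model [⋀^Fin 2]→L[ℝ] ℝ from θ x) ![v, w] =
        θκ (F x) ![mfderiv 𝓘(ℝ, B.model) 𝓘(ℝ, A.model) F x v, mfderiv 𝓘(ℝ, B.model) 𝓘(ℝ, A.model) F x w] := by
    intro x v w
    change (θκ.pullback 𝓘(ℝ, B.model) F) x ![v, w] = _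
    rw [MForm.pullback_apply]
    congr 1
    funext i
    fin_cases i <;> rfl
  have hdFI : ∀ (x : B.carrier) (v : B.model),
      mfderiv 𝓘(ℝ, B.model) 𝓘(ℝ, A.model) F x (Complex.I • v) =
        (Complex.I • (show A.model from mfderiv 𝓘(ℝ, B.model) 𝓘(ℝ, A.model) F x v) : A.model) :=
    fun x v ↦ mfderiv_real_apply_smul (hFd x) Complex.I v
  have hJ : ∀ (x : B.carrier) (v w : B.model),
      (show B.model [⋀^Fin 2]→L[ℝ] ℝ from θ x) ![Complex.I • v, Complex.I • w] =
        (show B.model [⋀^Fin 2]→L[ℝ] ℝ from θ x) ![v, w] := by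
    intro x v w
    rw [hθapp, hθapp, hdFI, hdFI]
    exact fubiniStudyPullbackForm_tangentJ A.isAnalytification (F x) _ _
  have hnn : ∀ (x : B.carrier) (v : B.model),
      0 ≤ (show B.model [⋀^Fin 2]→L[ℝ] ℝ from θ x) ![v, Complex.I • v] := by
    intro x v
    rw [hθapp, hdFI]
    exact fubiniStudyPullbackForm_self_tangentJ_nonneg A.isAnalytification (F x) _
  have hpos : ∀ v : B.model, v ≠ 0 → 0 < (show B.model [⋀^Fin 2]→L[ℝ] ℝ from θ b₀) ![v, Complex.I • v] := by
    intro v hv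
    rw [hθapp, hdFI]
    refine fubiniStudyPullbackForm_pos A.isAnalytification (F b₀) _ fun h0 ↦ hv (hinj ?_)
    exact h0.trans (map_zero (mfderiv 𝓘(ℝ, B.model) 𝓘(ℝ, A.model) F b₀)).symm
  -- `θ^d` is not exact, so its class is non-zero
  have hdim : finrank ℂ B.model = d := B.isAnalytification.finrank_eq
  have hex : MForm.twoFormPow 𝓘(ℝ, B.model) B.carrier θ d ∉
      exactSmoothForms 𝓘(ℝ, B.model) B.carrier ℝ (2 * d) := by
    have h := twoFormPow_finrank_not_mem_exactSmoothForms (x₀ := b₀) hθs hJ hnn hpos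
    rwa [hdim] at h
  have hcls : deRhamCohomology.mk ⟨MForm.twoFormPow 𝓘(ℝ, B.model) B.carrier θ d,
      twoFormPow_mem_closedSmoothForms hθc d⟩ ≠ 0 := by
    intro h0
    rw [← map_zero (deRhamCohomology.mk (I := 𝓘(ℝ, B.model)) (M := B.carrier) (F := ℝ) (k := 2 * d)),
      deRhamCohomology.mk_eq_mk_iff, Submodule.coe_zero, sub_zero] at h0
    exact hex h0
  -- the comparisons by integration and the hyperplane-type class `H` of `Y`
  set eB := integrationDeRhamIsoFamily B.model with heB
  set eA := integrationDeRhamIsoFamily A.model with heA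
  obtain ⟨H, hH⟩ := A.pullback_surjective 2
    (ofRealClass A.carrier 2 (eA A.carrier 2 (deRhamCohomology.mk ⟨θκ, hθκc⟩)))
  -- `B^* (τ^* H) = e_B[θ] ⊗ 1`
  set τc := Motives.AlgPoints.mapContinuous (L := ℂ) τ with hτc
  have hpull : B.pullback 2 (singularCohomology.map ℂ ℂ τc 2 H) =
      ofRealClass B.carrier 2 (eB B.carrier 2 (deRhamCohomology.mk ⟨θ, hθc⟩)) := by
    rw [← HodgeModel.map_anMap_pullback A B τ 2 H, hH, ← ofRealClass_map]
    congr 1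
    have hnat := Literature.Geometry.Manifold.integrationDeRhamIsoFamily_map_of_contMDiff
      (E := B.model) (E' := A.model) (M := B.carrier) (N := A.carrier) hFs 2
      (deRhamCohomology.mk ⟨θκ, hθκc⟩)
    rw [deRhamCohomology.map_mk] at hnat
    exact hnat.symm
  -- hence `B^* (τ^* H^d) = e_B[θ^d] ⊗ 1 ≠ 0`
  have hpow : B.pullback (2 * d) (singularCohomology.map ℂ ℂ τc (2 * d) (cupPowTwo H d)) =
      ofRealClass B.carrier (2 * d) (eB B.carrier (2 * d) (deRhamCohomology.mk
        ⟨MForm.twoFormPow 𝓘(ℝ, B.model) B.carrier θ d, twoFormPow_mem_closedSmoothForms hθc d⟩)) := by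
    rw [map_cupPowTwo]
    change singularCohomology.map ℂ ℂ _ (2 * d) (cupPowTwo _ d) = _
    rw [map_cupPowTwo]
    change cupPowTwo (B.pullback 2 (singularCohomology.map ℂ ℂ τc 2 H)) d = _
    rw [hpull]
    exact cupPowTwo_ofRealClass_twoFormPow eB integrationDeRhamIsoFamily_isMultiplicative hθc hd1
  refine map_fundamentalClass_ne_zero_of_map_ne_zero μ hV τc (c := cupPowTwo H d) fun h0 ↦ ?_
  have h1 : B.pullback (2 * d) (singularCohomology.map ℂ ℂ τc (2 * d) (cupPowTwo H d)) = 0 := by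
    rw [h0, map_zero]
  rw [hpow] at h1
  have h2 := ofRealClass_injective (2 * d) (h1.trans (map_zero _).symm)
  exact hcls ((LinearEquiv.map_eq_zero_iff _).1 h2)


end HodgeTheory

end Literature.AlgebraicGeometry.HodgeTheory

end
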